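import Summits.QuantumFields.YangMills.Theorems.BalabanLadderIRTwistedSlabAnchorSU
import HarnessLib

/-!
# T1 for `SU(N)` in WINDOW FORM: `∃ Λ → ∞, ∀ β, ∀ L ≤ Λ(β)` — the `∀ L ∃ β₀(L)` theorem (K39) read as a growing box window, and
# what the transposition M4 adds (`Λ ≡ ∞`)

HELPER toward stub **T1** `TwistedSlabAnchor` of LINE `twisted-slab-continuity` (crux `IRcof`, stmt-QuantumFields-26930, census row 43;
LEAD prover ym-ir-line-tsc-p1 g6; `--supports` the crux, `--as helper`).  Theorems only.  K42 of the T1 programme.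

* `exists_window_of_forall_exists_threshold` — pure order bookkeeping: from `∀ L ≥ 2, ∃ β₀(L), ∀ β ≥ β₀(L), Q β L` one gets a WINDOW
  `Λ : ℝ → ℕ` with `Λ β → ∞` and `Q β L` for all `β` and all `2 ≤ L ≤ Λ β` (take `Λ β` = the largest `L ≤ ⌊β⌋₊` whose running maximum of
  thresholds is `≤ β`).  No rate: `Λ` grows as slowly as the thresholds `β₀(L)` force.
* ★★ `twistedSlabAnchor_su_fundamental_window` — for `N ≥ 2`, `k` a unit, `n ≥ 1`, `(ω^k·1)^n = 1`: `∃ ℓ₀ c C Λ, 2 ≤ ℓ₀ ∧ 0 < c ∧ Λ β → ∞ ∧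
  ∀ β, ∀ L, 2 ≤ L ≤ Λ β → ∀ t ≥ 1, projSlabDefect (fundamentalLatticeRep N).ρ β (ω^k·1) n ℓ₀ L t ≤ C·L·e^{−ct}` — T1's bound, with T1's
  constants, on every box of long extent up to `Λ(β)`, a window opening to infinity with the coupling (K39 + the bookkeeping lemma).
* `twistedSlabAnchor_body_iff_window_top` — the stub's body at `(SU(N), ω^k·1, fund)` is EXACTLY the window form with `Λ ≡ ⊤` (every `L`);
  so what M4 (the transposition `∀L∃β₀ → ∃β₀∀L`) adds is precisely the removal of the ceiling `Λ(β)`.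

WHY (for the line): T2 `TransverseSizeContinuity` consumes the anchor only at scales `λ ≤ a(β)·L ≤ T`, i.e. on boxes `L ≤ T∕a(β)`; the window
form makes the remaining debt QUANTITATIVE — the composition would go through with a windowed anchor as soon as `Λ(β)·a(β) ≥ T` eventually,
i.e. `Λ(β) ≳ T·e^{Bβ}` under the asymptotic-freedom floor `LowerBounds`; K39 gives SOME `Λ → ∞` with no rate, M4 gives `Λ ≡ ∞`.  (A reshape
of T1∕T2 to the windowed form is the line owner's call; this file only records the typed fact.)  HONEST FRAMING: bookkeeping; no estimate is
improved; T1 0∕1; IRcof ∕ IR 0∕1; the Yang–Mills mass gap (Clay) is NOT proved; R4 = `BalabanLadder.UV` only.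
References: G. 't Hooft, Nucl. Phys. B 153 (1979) §5.
-/

set_option autoImplicit false

noncomputable section

open Filter Topology
open Literature.MathematicalPhysics.QuantumFieldTheory Literature.MathematicalPhysics.QuantumLattice

namespace Summit.QuantumFields.YangMills.Cruxes.IRcof.TwistedSlab

/-! ## §1 Thresholds `β₀(L)` ⇒ a window `L ≤ Λ(β)` with `Λ → ∞` -/

/-- **Window bookkeeping**: if for every `L ≥ 2` a property `Q β L` holds for all `β` beyond some threshold `β₀(L)`, then there is
`Λ : ℝ → ℕ` with `Λ β → ∞` such that `Q β L` holds for every `β` and every `2 ≤ L ≤ Λ β`.  (`Λ β` := the largest `L ≤ ⌊β⌋₊` whose running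
maximum of thresholds `max_{L' ≤ L} β₀(L')` is `≤ β`.) [folklore] -/
theorem exists_window_of_forall_exists_threshold {Q : ℝ → ℕ → Prop}
    (h : ∀ L : ℕ, 2 ≤ L → ∃ β₀ : ℝ, ∀ β : ℝ, β₀ ≤ β → Q β L) :
    ∃ Λ : ℝ → ℕ, Tendsto Λ atTop atTop ∧ ∀ (β : ℝ) (L : ℕ), 2 ≤ L → L ≤ Λ β → Q β L := by
  classical
  -- thresholds, extended by `0` below `L = 2`
  have hch : ∀ L : ℕ, ∃ β₀ : ℝ, 2 ≤ L → ∀ β : ℝ, β₀ ≤ β → Q β L := fun L => by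
    by_cases hL : 2 ≤ L
    · obtain ⟨β₀, hβ₀⟩ := h L hL
      exact ⟨β₀, fun _ => hβ₀⟩
    · exact ⟨0, fun h2 => absurd h2 hL⟩
  choose β₀ hβ₀ using hch
  -- running maximum `B L = max_{L' ≤ L} β₀ L'`
  let B : ℕ → ℝ := fun L => (Finset.range (L + 1)).sup' ⟨0, by simp⟩ β₀
  have hBge : ∀ L, β₀ L ≤ B L := fun L => Finset.le_sup' β₀ (by simp)
  have hBmono : ∀ {L L' : ℕ}, L ≤ L' → B L ≤ B L' := fun {L L'} hLL' =>
    Finset.sup'_le _ _ fun i hi => Finset.le_sup' β₀ (by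
      simp only [Finset.mem_range] at hi ⊢; omega)
  -- the window
  let Λ : ℝ → ℕ := fun β => Nat.findGreatest (fun L => B L ≤ β) ⌊β⌋₊
  refine ⟨Λ, ?_, fun β L hL hLΛ => ?_⟩
  · -- `Λ β → ∞`: for `β ≥ max (B L₀) L₀`, `L₀ ≤ Λ β`
    refine tendsto_atTop_atTop.2 fun L₀ => ⟨max (B L₀) (L₀ : ℝ), fun β hβ => ?_⟩
    have h1 : B L₀ ≤ β := (le_max_left _ _).trans hβ
    have h2 : (L₀ : ℝ) ≤ β := (le_max_right _ _).trans hβ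
    exact Nat.le_findGreatest (Nat.le_floor h2) h1
  · -- inside the window the running maximum, hence the threshold, is below `β`
    have hΛ0 : Λ β ≠ 0 := by
      intro h0; rw [h0] at hLΛ; omega
    have hspec : B (Λ β) ≤ β := Nat.findGreatest_of_ne_zero rfl hΛ0
    exact hβ₀ L hL β ((hBge L).trans ((hBmono hLΛ).trans hspec))

/-! ## §2 T1 for `SU(N)` as a window opening to infinity -/

variable {N : ℕ} [NeZero N] {k : ZMod N}

/-- ★★ **T1 FOR `SU(N)` IN WINDOW FORM.**  For `N ≥ 2`, `k` a unit (`z = ω^k·1`), `n ≥ 1` with `z^n = 1`: there are `ℓ₀ ≥ 2`, `c > 0`, `C` and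
a window `Λ : ℝ → ℕ` with `Λ β → ∞` such that for EVERY `β`, every `2 ≤ L ≤ Λ β` and every `t ≥ 1`,
`projSlabDefect (fundamentalLatticeRep N).ρ β z n ℓ₀ L t ≤ C·L·e^{−ct}` — K39's `∀ L ∃ β₀(L)` theorem, transposed into a growing box window;
the located debt M4 is `Λ ≡ ∞`. [cite: tHooft1979Flux, §5 (5.1)–(5.4)] -/
theorem twistedSlabAnchor_su_fundamental_window (hN : 2 ≤ N) (hk : IsUnit k) {n : ℕ} (hn : 0 < n)
    (hzn : (suCenter N k : Matrix.specialUnitaryGroup (Fin N) ℂ) ^ n = 1) :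
    ∃ (ℓ₀ : ℕ) (c C : ℝ) (Λ : ℝ → ℕ), 2 ≤ ℓ₀ ∧ 0 < c ∧ Tendsto Λ atTop atTop ∧
      ∀ (β : ℝ) (L : ℕ), 2 ≤ L → L ≤ Λ β → ∀ t : ℕ, 1 ≤ t →
        projSlabDefect (fundamentalLatticeRep N).ρ β (suCenter N k : Matrix.specialUnitaryGroup (Fin N) ℂ) n ℓ₀ L t ≤
          C * (L : ℝ) * Real.exp (-(c * (t : ℝ))) := by
  obtain ⟨ℓ₀, c, C, hℓ₀, hc, h⟩ := twistedSlabAnchor_su_fundamental_threshold (N := N) hN hk hn hzn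
  obtain ⟨Λ, hΛ, hwin⟩ := exists_window_of_forall_exists_threshold
    (Q := fun β L => ∀ t : ℕ, 1 ≤ t →
      projSlabDefect (fundamentalLatticeRep N).ρ β (suCenter N k : Matrix.specialUnitaryGroup (Fin N) ℂ) n ℓ₀ L t ≤
        C * (L : ℝ) * Real.exp (-(c * (t : ℝ)))) h
  exact ⟨ℓ₀, c, C, Λ, hℓ₀, hc, hΛ, fun β L hL hLΛ => hwin β L hL hLΛ⟩

omit [NeZero N] in
/-- **What the transposition adds.**  For fixed data `(ℓ₀, c, C)` the stub's body at `(SU(N), ω^k·1, fundamentalLatticeRep N)` —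
`∃ β₀ ∀ β ≥ β₀ ∀ L ≥ 2 ∀ t ≥ 1, …` — holds iff the window form holds with a window that is EVENTUALLY EVERYTHING
(`∃ β₀, ∀ β ≥ β₀, ∀ L, L ≤ Λ β`, e.g. `Λ ≡ ⊤` beyond `β₀`): M4 is exactly the removal of the ceiling. [folklore] -/
theorem twistedSlabAnchor_body_iff_window_top {n : ℕ} (ℓ₀ : ℕ) (c C : ℝ) :
    (∃ β₀ : ℝ, ∀ β : ℝ, β₀ ≤ β → ∀ L t : ℕ, 2 ≤ L → 1 ≤ t →
        projSlabDefect (fundamentalLatticeRep N).ρ β (suCenter N k : Matrix.specialUnitaryGroup (Fin N) ℂ) n ℓ₀ L t ≤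
          C * (L : ℝ) * Real.exp (-(c * (t : ℝ)))) ↔
      ∃ (Λ : ℝ → ℕ∞) (β₀ : ℝ), (∀ β : ℝ, β₀ ≤ β → Λ β = ⊤) ∧
        ∀ (β : ℝ) (L : ℕ), 2 ≤ L → (L : ℕ∞) ≤ Λ β → ∀ t : ℕ, 1 ≤ t →
          projSlabDefect (fundamentalLatticeRep N).ρ β (suCenter N k : Matrix.specialUnitaryGroup (Fin N) ℂ) n ℓ₀ L t ≤
            C * (L : ℝ) * Real.exp (-(c * (t : ℝ))) := by
  constructor
  · rintro ⟨β₀, h⟩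
    classical
    refine ⟨fun β => if β₀ ≤ β then ⊤ else 0, β₀, fun β hβ => by simp [hβ], fun β L hL hLΛ t ht => ?_⟩
    by_cases hβ : β₀ ≤ β
    · exact h β hβ L t hL ht
    · simp only [hβ, if_false, nonpos_iff_eq_zero, Nat.cast_eq_zero] at hLΛ
      omega
  · rintro ⟨Λ, β₀, htop, h⟩
    exact ⟨β₀, fun β hβ L t hL ht => h β L hL (by rw [htop β hβ]; exact le_top) t ht⟩

end Summit.QuantumFields.YangMills.Cruxes.IRcof.TwistedSlab

end
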